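import Mathlib
import Literature.AlgebraicGeometry.Resolution.PointBlowupFlagInvariant
import Literature.AlgebraicGeometry.Resolution.PointBlowupHeightVectorDrops
import Literature.AlgebraicGeometry.Resolution.PointBlowupFlagShiftBound
import Literature.AlgebraicGeometry.Resolution.PointBlowupFlagMaximalShift
import Summits.ResolutionOfSingularities.ResolutionOfSingularities.Theorems.WeightedInvariantLocalWeightedDropInsepCleaning
import Summits.ResolutionOfSingularities.ResolutionOfSingularities.Theorems.WeightedInvariantLocalWeightedDropInsepNewtonMeasures
import Summits.ResolutionOfSingularities.ResolutionOfSingularities.Theorems.WeightedInvariantLocalWeightedDropInsepNewtonVMove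
import Summits.ResolutionOfSingularities.ResolutionOfSingularities.Theorems.WeightedInvariantLocalWeightedDropInsepNewtonVHeight
import Summits.ResolutionOfSingularities.ResolutionOfSingularities.Theorems.WeightedInvariantLocalWeightedDropInsepNewtonSlope
import Summits.ResolutionOfSingularities.ResolutionOfSingularities.Theorems.WeightedInvariantLocalWeightedDropInsepNewtonClean
import Summits.ResolutionOfSingularities.ResolutionOfSingularities.Theorems.WeightedInvariantLocalWeightedDropInsepNewtonShear
import Summits.ResolutionOfSingularities.ResolutionOfSingularities.Theorems.WeightedInvariantLocalWeightedDropInsepNewtonTMove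

/-!
# `WeightedInvariant.LocalWeightedDrop`, line `hasse-ridge-face-selection`: HAUSER–WAGNER'S SLOPE IS BOUNDED OVER ALL SUBORDINATE
# SHEARS unless the class is a hidden monomial (the «max» of [HW14] p. 192, made honest) — unit M6b of stub-3's M6 design memo

Crux item stmt-ResolutionOfSingularities-8899 `LocalWeightedDrop` (route `ResolutionOfSingularities/WeightedInvariant`),
serving the door `WeightedConstruction` stmt-ResolutionOfSingularities-0571.  [OURS · L1 W4.3, chain w43, stub worker 3
(gen 3): §3 of L/res-L1-w43-stub-3/M6-DESIGN.md («the one genuinely open lemma»), calibration track of the closed stub S2iM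
`stub_charTwoInseparableReductionWon` (CHAIN D12); NOT a statement of any manuscript.  Hauser–Wagner (L'Enseignement Math. 60
(2014) §4 p. 192) DEFINE `Slope_a(f) = max {Slope(F) ; (y,z) realising}` without proving that the maximum exists; the proof below is
Hauser–Perlega's limit-flag argument (PRIMS 60 (2024) Prop. 3, p. 792), kernel in res-L1-w43-stub-6's
`HauserPerlega2024.exists_inf_rows_eq_top_or_bounded` (Literature/…/PointBlowupFlagMaximalShift.lean), re-read for the slope.]

Characteristic `2`, orientation free `= 0`, rigid `= 1`, shears `θ_φ : x₀ ↦ x₀ + φ(x₁)` and `G_φ = clean₂(θ_φ^* F)`.  For a CLEAN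
`F ≠ 0` whose highest vertex `(α₁, β₁)` is its ONLY initial point (`ord F = α₁ + β₁` — the only situation in which the (H)-move keeps the
height, `…InsepNewtonSlope.degAlongPS_hSucc_eq_of_heightPS_eq`, and therefore the only one in which the slope is ever consulted) and `α₁ ≥ 2`:
* `order_row_cleanShear` : the rows `R_φ i(z) = Σ_v [x₀^i x₁^{β₁+v}] G_φ · z^v` of the Literature lemma have `ord R_φ i + β₁ = fiberMin_i(G_φ)`;
* **`exists_heightPS_cleanShear_eq_zero_or_slopePS_le`**: EITHER some shear exhibits the hidden monomial (`height(G_φ) = 0`, all fibres left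
  of the vertex empty — the terminal case of the game) OR there is ONE bound `B` with `slope(G_φ) ≤ B` for EVERY shear `φ`.
With the trivial bound `slope < α₁` when `ord F < α₁ + β₁` (`slopePS_lt_of_order_lt`), the sup `S(f)` of M6-DESIGN §1 is finite for every
non-terminal class.
-/

set_option linter.dupNamespace false -- mandated namespace of this single-conjunct summit

namespace Summit.ResolutionOfSingularities.ResolutionOfSingularities.Theorems

namespace InsepNewton

open MvPowerSeries
open Literature.AlgebraicGeometry.Resolution
open Literature.AlgebraicGeometry.Resolution.HauserPerlega2024 (ordAlong cleanSeries)
open Literature.AlgebraicGeometry.Resolution.HauserWagner2014 (ordVarPS degAlongPS heightPS fiberMinPS fiberSlopePS slopePS)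

variable {K : Type} [Field K]

/-! ### The trivial bound: an initial point left of the vertex -/

/-- If the highest vertex is NOT the only initial point (`ord H < α₁ + β₁`), some initial point lies strictly left of it and the slope is
`< α₁` (the edge to it is flatter than the antidiagonal). -/
theorem slopePS_lt_of_order_lt {H : MvPowerSeries (Fin 2) K} (hH : H ≠ 0)
    (hlt : H.order < ((degAlongPS H 1 0 + ordVarPS H 1 : ℕ) : ℕ∞)) :
    slopePS H 1 0 < ((degAlongPS H 1 0 : ℚ) : WithTop ℚ) := by
  -- an initial point `e`
  obtain ⟨e, he', hdeg⟩ := exists_coeff_ne_zero_and_order ((ne_zero_iff_order_finite (f := H)).mp hH)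
  have he := coeff_single_add_single_ne_zero he'
  have hdege : (e.degree : ℕ∞) = ((e 0 + e 1 : ℕ) : ℕ∞) := by
    conv_lhs => rw [(coeff_single_add_single_eq e).symm]
    rw [degree_pair]
  rw [← hdeg, hdege] at hlt
  have hlt' : e 0 + e 1 < degAlongPS H 1 0 + ordVarPS H 1 := by exact_mod_cast hlt
  have hβ : ordVarPS H 1 ≤ e 1 := by have := ordVarPS_le 1 he; rwa [pair_apply_one] at this
  have hα : e 0 < degAlongPS H 1 0 := by omega
  -- its fibre contribution is `< α₁`
  have hfib : fiberMinPS H 1 0 (e 0) ≤ (e 1 : ℕ∞) := fiberMinPS_le he' rfl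
  have hne : fiberMinPS H 1 0 (e 0) ≠ ⊤ := ne_top_of_le_ne_top (ENat.coe_ne_top _) hfib
  refine lt_of_le_of_lt (slopePS_le_fiberSlopePS hα) ?_
  rw [fiberSlopePS_of_ne_top hne, WithTop.coe_lt_coe]
  have hfib' : (fiberMinPS H 1 0 (e 0)).toNat ≤ e 1 := by
    have h := hfib
    rw [← ENat.coe_toNat hne] at h
    exact_mod_cast h
  have h1 : (((fiberMinPS H 1 0 (e 0)).toNat : ℕ) : ℚ) - (ordVarPS H 1 : ℚ) < (degAlongPS H 1 0 : ℚ) - (e 0 : ℚ) := by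
    have : ((fiberMinPS H 1 0 (e 0)).toNat : ℚ) ≤ (e 1 : ℚ) := by exact_mod_cast hfib'
    have h2 : (e 0 : ℚ) + (e 1 : ℚ) < (degAlongPS H 1 0 : ℚ) + (ordVarPS H 1 : ℚ) := by exact_mod_cast hlt'
    linarith
  have hpos : (0 : ℚ) < (degAlongPS H 1 0 : ℚ) - (e 0 : ℚ) := by
    have : (e 0 : ℚ) < (degAlongPS H 1 0 : ℚ) := by exact_mod_cast hα
    linarith
  have hαpos : (0 : ℚ) < (degAlongPS H 1 0 : ℚ) := by
    have : (0 : ℚ) ≤ (e 0 : ℚ) := Nat.cast_nonneg _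
    linarith
  calc (degAlongPS H 1 0 : ℚ) * ((((fiberMinPS H 1 0 (e 0)).toNat : ℕ) : ℚ) - (ordVarPS H 1 : ℚ)) /
        ((degAlongPS H 1 0 : ℚ) - (e 0 : ℚ))
      < (degAlongPS H 1 0 : ℚ) * ((degAlongPS H 1 0 : ℚ) - (e 0 : ℚ)) / ((degAlongPS H 1 0 : ℚ) - (e 0 : ℚ)) := by
        apply div_lt_div_of_pos_right _ hpos
        exact mul_lt_mul_of_pos_left h1 hαpos
    _ = (degAlongPS H 1 0 : ℚ) := by rw [mul_div_assoc, div_self hpos.ne', mul_one]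

/-! ### The rows of the cleaned shears, as the Literature lemma reads them -/

/-- No row of `G_φ = clean₂(θ_φ^* F)` below `β₁(F)`. -/
theorem coeff_cleanShear_eq_zero_of_lt (φ : PowerSeries K) (hφ : PowerSeries.constantCoeff φ = 0) (F : MvPowerSeries (Fin 2) K)
    (i : ℕ) {a : ℕ} (ha : a < ordVarPS F 1) :
    coeff (Finsupp.single 0 i + Finsupp.single 1 a) (cleanSeries 2 (subst (fun l : Fin 2 => if l = 0 then
      (X 0 : MvPowerSeries (Fin 2) K) + PowerSeries.subst (X 1 : MvPowerSeries (Fin 2) K) φ else X l) F)) = 0 := by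
  by_contra h
  exact coeff_shear_ne_zero_of_cleanShear φ F h (coeff_shear_eq_zero_of_lt hφ F i ha)

/-- **THE ROW ORDER IS THE FIBRE MINIMUM**: for the row `R_φ i(z) = Σ_v [x₀^i x₁^{β₁+v}] G_φ · z^v`,
`ord(R_φ i) + β₁ = fiberMin_i(G_φ)` (both sides `⊤` on an empty fibre). -/
theorem order_row_cleanShear {φ : PowerSeries K} (hφ : PowerSeries.constantCoeff φ = 0) (F : MvPowerSeries (Fin 2) K) (i : ℕ) :
    (PowerSeries.mk fun v => coeff (Finsupp.single 0 i + Finsupp.single 1 (ordVarPS F 1 + v))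
        (cleanSeries 2 (subst (fun l : Fin 2 => if l = 0 then (X 0 : MvPowerSeries (Fin 2) K) +
          PowerSeries.subst (X 1 : MvPowerSeries (Fin 2) K) φ else X l) F))).order + (ordVarPS F 1 : ℕ∞) =
      fiberMinPS (cleanSeries 2 (subst (fun l : Fin 2 => if l = 0 then (X 0 : MvPowerSeries (Fin 2) K) +
        PowerSeries.subst (X 1 : MvPowerSeries (Fin 2) K) φ else X l) F)) 1 0 i := by
  set G := cleanSeries 2 (subst (fun l : Fin 2 => if l = 0 then (X 0 : MvPowerSeries (Fin 2) K) +
    PowerSeries.subst (X 1 : MvPowerSeries (Fin 2) K) φ else X l) F) with hG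
  set R := PowerSeries.mk fun v => coeff (Finsupp.single 0 i + Finsupp.single 1 (ordVarPS F 1 + v)) G with hR
  refine le_antisymm ?_ ?_
  · -- `≤`: a point of the fibre realising the minimum gives a coefficient of the row
    by_cases htop : fiberMinPS G 1 0 i = ⊤
    · rw [htop]; exact le_top
    obtain ⟨d, hd, hd0, hd1⟩ := exists_eq_fiberMinPS htop
    have hd' := coeff_single_add_single_ne_zero hd
    rw [hd0] at hd'
    have hβ : ordVarPS F 1 ≤ d 1 := by
      by_contra hlt
      exact hd' (coeff_cleanShear_eq_zero_of_lt φ hφ F i (not_le.mp hlt))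
    have hcoef : PowerSeries.coeff (d 1 - ordVarPS F 1) R ≠ 0 := by
      rw [hR, PowerSeries.coeff_mk, show ordVarPS F 1 + (d 1 - ordVarPS F 1) = d 1 by omega]
      exact hd'
    have hle := PowerSeries.order_le (d 1 - ordVarPS F 1) hcoef
    rw [← hd1]
    calc R.order + (ordVarPS F 1 : ℕ∞) ≤ ((d 1 - ordVarPS F 1 : ℕ) : ℕ∞) + (ordVarPS F 1 : ℕ∞) := add_le_add hle le_rfl
      _ = (d 1 : ℕ∞) := by rw [← Nat.cast_add]; congr 1; omega
  · -- `≥`: the first coefficient of the row is a point of the fibre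
    by_cases hR0 : R = 0
    · rw [hR0, PowerSeries.order_zero, top_add]; exact le_top
    have hfin : R.order ≠ ⊤ := fun h => hR0 (PowerSeries.order_eq_top.mp h)
    set n := R.order.toNat with hn
    have hRn : R.order = n := (ENat.coe_toNat hfin).symm
    have hcoef : PowerSeries.coeff n R ≠ 0 := by
      have := PowerSeries.coeff_order hR0
      rwa [← hn] at this
    rw [hR, PowerSeries.coeff_mk] at hcoef
    rw [hRn, ← Nat.cast_add]
    have := fiberMinPS_le (rig := 1) (free := 0) hcoef (pair_apply_zero _ _)
    rw [pair_apply_one] at this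
    rw [add_comm]
    exact this

section CharTwo

variable [CharP K 2]

/-- **HAUSER–WAGNER'S SLOPE IS BOUNDED — OR THE CLASS IS A HIDDEN MONOMIAL.**  `F` clean, non-zero, whose highest vertex is its only initial
point (`ord F = α₁ + β₁`) with `α₁ ≥ 2`.  Then EITHER some subordinate shear `φ` has `height(clean₂ θ_φ^* F) = 0` (all fibres left of the
vertex are empty: the position is a monomial times a unit in those coordinates, `heightPS_eq_zero_iff`) OR there is a bound `B` with
`slope(clean₂ θ_φ^* F) ≤ B` for EVERY `φ` — so "`Slope_a(f) = max{…}`" is a maximum over a bounded set of rationals with denominators `≤ α₁`.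
The proof is Hauser–Perlega's limit flag (stub-6's `exists_inf_rows_eq_top_or_bounded` with `d = α₁`, `r = β₁`, weights `α₁!/(α₁ − i)`).
[cite: HauserWagner2014, §4 p. 192 l. 7–11 (definition of Slope_a as a max); HauserPerlega2024, Prop. 3 p. 792] -/
theorem exists_heightPS_cleanShear_eq_zero_or_slopePS_le {F : MvPowerSeries (Fin 2) K} (hF : F ≠ 0) (hclean : cleanSeries 2 F = F)
    (hα : 2 ≤ degAlongPS F 1 0) (hord : F.order = ((degAlongPS F 1 0 + ordVarPS F 1 : ℕ) : ℕ∞)) :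
    (∃ φ : PowerSeries K, PowerSeries.constantCoeff φ = 0 ∧
        heightPS (cleanSeries 2 (subst (fun l : Fin 2 => if l = 0 then (X 0 : MvPowerSeries (Fin 2) K) +
          PowerSeries.subst (X 1 : MvPowerSeries (Fin 2) K) φ else X l) F)) 1 0 = 0) ∨
      ∃ B : ℕ, ∀ φ : PowerSeries K, PowerSeries.constantCoeff φ = 0 →
        slopePS (cleanSeries 2 (subst (fun l : Fin 2 => if l = 0 then (X 0 : MvPowerSeries (Fin 2) K) +
          PowerSeries.subst (X 1 : MvPowerSeries (Fin 2) K) φ else X l) F)) 1 0 ≤ ((B : ℚ) : WithTop ℚ) := by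
  classical
  haveI : Fact (2 : ℕ).Prime := ⟨Nat.prime_two⟩
  set α₁ := degAlongPS F 1 0 with hα₁
  set β₁ := ordVarPS F 1 with hβ₁
  -- the rows of all cleaned shears, relative to `x₁^{β₁}`
  set R : PowerSeries K → ℕ → PowerSeries K := fun φ i => PowerSeries.mk fun v =>
    coeff (Finsupp.single 0 i + Finsupp.single 1 (β₁ + v)) (cleanSeries 2 (subst (fun l : Fin 2 => if l = 0 then
      (X 0 : MvPowerSeries (Fin 2) K) + PowerSeries.subst (X 1 : MvPowerSeries (Fin 2) K) φ else X l) F)) with hRdef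
  have hR : ∀ φ j v, PowerSeries.coeff v (R φ j) = coeff (Finsupp.single (1 : Fin 2) (β₁ + v) + Finsupp.single 0 j)
      (cleanSeries (2 ^ 1) (subst (fun l : Fin 2 => if l = 0 then (X 0 : MvPowerSeries (Fin 2) K) +
        PowerSeries.subst (X 1 : MvPowerSeries (Fin 2) K) φ else X l) F)) := fun φ j v => by
    rw [hRdef, PowerSeries.coeff_mk, pow_one, add_comm (Finsupp.single (1 : Fin 2) (β₁ + v))]
  -- the hypotheses of the limit-flag lemma
  have hxr : ∀ m : Fin 2 →₀ ℕ, coeff m F ≠ 0 → β₁ ≤ m 1 := fun m hm => ordVarPS_le 1 hm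
  have hminH : ∀ m : Fin 2 →₀ ℕ, coeff m F ≠ 0 → β₁ + α₁ ≤ m 1 + m 0 := by
    intro m hm
    have h := order_le hm
    rw [hord, (coeff_single_add_single_eq m).symm, degree_pair] at h
    have : α₁ + β₁ ≤ m 0 + m 1 := by exact_mod_cast h
    omega
  have hexH : ∃ m : Fin 2 →₀ ℕ, coeff m (cleanSeries (2 ^ 1) F) ≠ 0 ∧ m 1 + m 0 = β₁ + α₁ :=
    ⟨Finsupp.single 0 α₁ + Finsupp.single 1 β₁, by rw [pow_one, hclean]; exact coeff_vertex_ne_zero hF,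
      by rw [pair_apply_one, pair_apply_zero]⟩
  have hq : 2 ^ 1 ≤ α₁ := by rw [pow_one]; exact hα
  rcases HauserPerlega2024.exists_inf_rows_eq_top_or_bounded (K := K) 2 (e := 1) (1 : Fin 2) 0 one_ne_zero
      (fun l => (eq_or_eq_of_ne (show (1 : Fin 2) ≠ 0 from one_ne_zero) l).symm) F β₁ α₁ hq hxr hminH hexH R hR with
    ⟨φ, hφ, htop⟩ | ⟨B, hB⟩
  · -- `s⟨φ⟩ = ∞`: every fibre left of the vertex is empty, the height is `0`
    refine Or.inl ⟨φ, hφ, ?_⟩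
    set G := cleanSeries 2 (subst (fun l : Fin 2 => if l = 0 then (X 0 : MvPowerSeries (Fin 2) K) +
      PowerSeries.subst (X 1 : MvPowerSeries (Fin 2) K) φ else X l) F) with hG
    have hG0 : G ≠ 0 := cleanShear_ne_zero hφ hF hclean
    have hGα : degAlongPS G 1 0 = α₁ := degAlongPS_cleanShear hφ hF hclean
    rw [Finset.inf_eq_top_iff] at htop
    -- every support point of `G` has free exponent `≥ α₁`
    have hsupp : ∀ d : Fin 2 →₀ ℕ, coeff d G ≠ 0 → α₁ ≤ d 0 := by
      intro d hd
      by_contra hlt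
      push Not at hlt
      have hi := htop (d 0) (Finset.mem_range.mpr hlt)
      have hordtop : (R φ (d 0)).order = ⊤ := by
        by_contra hne
        rw [← ENat.coe_toNat hne, ← Nat.cast_mul] at hi
        exact ENat.coe_ne_top _ hi
      have hfib := order_row_cleanShear hφ F (d 0)
      rw [← hβ₁, ← hG] at hfib
      change (R φ (d 0)).order + (β₁ : ℕ∞) = fiberMinPS G 1 0 (d 0) at hfib
      rw [hordtop, top_add] at hfib
      have := fiberMinPS_le (rig := 1) (free := 0) hd rfl
      rw [← hfib] at this
      exact absurd this (not_le.mpr (WithTop.coe_lt_top _))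
    have hoG : α₁ ≤ ordVarPS G 0 := by
      obtain ⟨d, hd, hd0⟩ := exists_coeff_apply_eq_ordVarPS 0 hG0
      rw [← hd0]; exact hsupp d hd
    rw [heightPS, hGα]
    omega
  · -- `s⟨φ⟩ ≤ B` for all `φ`: the slope is bounded by `B`
    refine Or.inr ⟨B, fun φ hφ => ?_⟩
    set G := cleanSeries 2 (subst (fun l : Fin 2 => if l = 0 then (X 0 : MvPowerSeries (Fin 2) K) +
      PowerSeries.subst (X 1 : MvPowerSeries (Fin 2) K) φ else X l) F) with hG
    have hG0 : G ≠ 0 := cleanShear_ne_zero hφ hF hclean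
    have hGα : degAlongPS G 1 0 = α₁ := degAlongPS_cleanShear hφ hF hclean
    have hGβ : ordVarPS G 1 = β₁ := ordVarPS_cleanShear_one hφ hF hclean
    have hBφ := hB φ hφ
    -- the infimum is attained at some `i < α₁`
    have hne : (Finset.range α₁).Nonempty := ⟨0, Finset.mem_range.mpr (by omega)⟩
    obtain ⟨i, hi, hinf⟩ := Finset.exists_mem_eq_inf (Finset.range α₁) hne
      (fun i => ((α₁.factorial / (α₁ - i) : ℕ) : ℕ∞) * (R φ i).order)
    rw [hinf] at hBφ
    have hiα : i < α₁ := Finset.mem_range.mp hi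
    -- the weight and the row order are finite
    have hwpos : 0 < α₁.factorial / (α₁ - i) :=
      Nat.div_pos (Nat.le_of_dvd (Nat.factorial_pos _) (Nat.dvd_factorial (by omega) (by omega))) (by omega)
    have hordfin : (R φ i).order ≠ ⊤ := by
      intro h
      have hw0 : ((α₁.factorial / (α₁ - i) : ℕ) : ℕ∞) ≠ 0 := by exact_mod_cast hwpos.ne'
      rw [h, ENat.mul_top hw0] at hBφ
      exact absurd hBφ (not_le.mpr (WithTop.coe_lt_top _))
    set n := (R φ i).order.toNat with hn
    have hRn : (R φ i).order = n := (ENat.coe_toNat hordfin).symm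
    rw [hRn, ← Nat.cast_mul] at hBφ
    have hwn : α₁.factorial / (α₁ - i) * n ≤ B := by exact_mod_cast hBφ
    -- the fibre `i` of `G`: `fiberMin_i = β₁ + n`
    have hfib := order_row_cleanShear hφ F i
    rw [← hβ₁, ← hG] at hfib
    change (R φ i).order + (β₁ : ℕ∞) = fiberMinPS G 1 0 i at hfib
    rw [hRn, ← Nat.cast_add] at hfib
    have hfibne : fiberMinPS G 1 0 i ≠ ⊤ := by rw [← hfib]; exact ENat.coe_ne_top _
    have hfibnat : (fiberMinPS G 1 0 i).toNat = n + β₁ := by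
      have h := congrArg ENat.toNat hfib.symm
      rwa [ENat.toNat_coe] at h
    -- `slope ≤ fiberSlope_i = α₁ n / (α₁ − i) ≤ (α₁!/(α₁ − i))·n ≤ B`
    refine (slopePS_le_fiberSlopePS (by rw [hGα]; exact hiα)).trans ?_
    rw [fiberSlopePS_of_ne_top hfibne, WithTop.coe_le_coe, hGα, hGβ, hfibnat]
    have hfac : (α₁ - i) * (α₁.factorial / (α₁ - i)) = α₁.factorial :=
      Nat.mul_div_cancel' (Nat.dvd_factorial (by omega) (by omega))
    have hαi : (0 : ℚ) < (α₁ : ℚ) - (i : ℚ) := by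
      have : (i : ℚ) < (α₁ : ℚ) := by exact_mod_cast hiα
      linarith
    rw [div_le_iff₀ hαi]
    have h1 : (α₁ : ℚ) ≤ (α₁.factorial : ℚ) := by exact_mod_cast Nat.self_le_factorial α₁
    have h2 : ((α₁.factorial : ℕ) : ℚ) = ((α₁ - i : ℕ) : ℚ) * ((α₁.factorial / (α₁ - i) : ℕ) : ℚ) := by
      rw [← Nat.cast_mul, hfac]
    have h3 : ((α₁ - i : ℕ) : ℚ) = (α₁ : ℚ) - (i : ℚ) := by rw [Nat.cast_sub hiα.le]
    have h4 : ((α₁.factorial / (α₁ - i) : ℕ) : ℚ) * (n : ℚ) ≤ (B : ℚ) := by exact_mod_cast hwn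
    have hn0 : (0 : ℚ) ≤ (n : ℚ) := Nat.cast_nonneg _
    calc (α₁ : ℚ) * (((n + β₁ : ℕ) : ℚ) - (β₁ : ℚ)) = (α₁ : ℚ) * (n : ℚ) := by push_cast; ring
      _ ≤ (α₁.factorial : ℚ) * (n : ℚ) := mul_le_mul_of_nonneg_right h1 hn0
      _ = ((α₁ : ℚ) - (i : ℚ)) * (((α₁.factorial / (α₁ - i) : ℕ) : ℚ) * (n : ℚ)) := by rw [h2, h3]; ring
      _ ≤ ((α₁ : ℚ) - (i : ℚ)) * (B : ℚ) := mul_le_mul_of_nonneg_left h4 hαi.le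
      _ = (B : ℚ) * ((α₁ : ℚ) - (i : ℚ)) := by ring

end CharTwo

end InsepNewton

end Summit.ResolutionOfSingularities.ResolutionOfSingularities.Theorems
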